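import Summits.Ventures.PercRepro.MSLemmaX
import Summits.Ventures.PercRepro.MSTightProduct

/-!
# Lemma X inside a sub-cube `2^M`, by free-coordinate extension

Dossier proofs/MINE1-theoremS.md, Addendum 57 suppl. 3–4; HANDOFF §mine-1 gen 32 → 33, step (K3).
`MSLemmaX.lean` proves Lemma X for up-sets of the FULL cube `Finset α`. The lane applies it to
up-sets WITHIN the addable part `M` of a trace (`IsUpSetWithin M U`, members `⊆ M`). Rather than
transporting along the subtype `↥M`, every family `S` of subsets of `M` is extended FREELY on the
coordinates outside `M`: `freeExt M S = S ⊻ 𝒫(univ ∖ M) = {s : s ∩ M ∈ S}` (`mem_freeExt`). The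
extension is an up-set of the full cube when `S` is an up-set within `M` (`isUpperSet_freeExt`),
it commutes with differences, unions, complements (`cofam (freeExt M S) = freeExt M (M − S)`,
`cofam_freeExt`) and with the «below some member of» filter (`filter_freeExt`), and it multiplies
every cardinality by `2^{|univ ∖ M|}` (`card_freeExt`). Lemma X for the extensions divided by
`2^{|univ ∖ M|}` is **Lemma X within `M`** (`lemmaX_within`): for up-sets `U₀ ⊆ U` within `M` with
`U ∖ U₀ ≠ ∅` and `T ⊊ U₀`, the members of `M − U₀` below some member of `(U ∖ U₀) ∪ T` number at
least `|T| + 1`.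
-/

namespace PercRepro.MSTight

open Finset
open scoped FinsetFamily

variable {α : Type*} [DecidableEq α] [Fintype α] {M : Finset α} {S S' : Finset (Finset α)}

section FreeExt

/-- The free extension of a family of subsets of `M`: every member with an arbitrary subset of
`univ ∖ M` added. -/
def freeExt (M : Finset α) (S : Finset (Finset α)) : Finset (Finset α) := S ⊻ (univ \ M).powerset

/-- Membership in the free extension: `s ∈ freeExt M S ↔ s ∩ M ∈ S`. -/
theorem mem_freeExt (hS : ∀ y ∈ S, y ⊆ M) {s : Finset α} : s ∈ freeExt M S ↔ s ∩ M ∈ S := by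
  unfold freeExt
  rw [mem_sups]
  constructor
  · rintro ⟨y, hy, w, hw, rfl⟩
    have hwM : w ∩ M = ∅ := by
      rw [← Finset.disjoint_iff_inter_eq_empty]
      exact disjoint_of_subset_left (mem_powerset.1 hw) sdiff_disjoint
    rw [sup_eq_union, union_inter_distrib_right, inter_eq_left.2 (hS y hy), hwM, union_empty]
    exact hy
  · intro h
    refine ⟨s ∩ M, h, s \ M, mem_powerset.2 (sdiff_subset_sdiff (subset_univ _) (Subset.refl _)),
      ?_⟩
    rw [sup_eq_union]
    ext a
    simp only [mem_union, mem_inter, mem_sdiff]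
    tauto

/-- `|freeExt M S| = |S| · 2^{|univ ∖ M|}`. -/
theorem card_freeExt (hS : ∀ y ∈ S, y ⊆ M) :
    (freeExt M S).card = S.card * 2 ^ (univ \ M).card := by
  unfold freeExt
  rw [card_sups_of_disjoint disjoint_sdiff hS (fun w hw => mem_powerset.1 hw), card_powerset]

/-- The free extension of an up-set within `M` is an up-set of the full cube. -/
theorem isUpperSet_freeExt (hS : ∀ y ∈ S, y ⊆ M) (hU : IsUpSetWithin M S) :
    IsUpperSet (freeExt M S : Set (Finset α)) := by
  intro s t hst hs
  rw [mem_coe, mem_freeExt hS] at hs ⊢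
  exact hU _ hs _ inter_subset_right (inter_subset_inter hst (Subset.refl _))

/-- The free extension is monotone. -/
theorem freeExt_subset_freeExt (h : S ⊆ S') : freeExt M S ⊆ freeExt M S' := by
  unfold freeExt
  exact sups_subset h (Subset.refl _)

/-- The free extension commutes with differences. -/
theorem freeExt_sdiff (hS : ∀ y ∈ S, y ⊆ M) (hS' : ∀ y ∈ S', y ⊆ M) :
    freeExt M S \ freeExt M S' = freeExt M (S \ S') := by
  ext s
  rw [mem_sdiff, mem_freeExt hS, mem_freeExt hS', mem_freeExt (fun y hy => hS y (mem_sdiff.1 hy).1),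
    mem_sdiff]

/-- The free extension commutes with unions. -/
theorem freeExt_union (hS : ∀ y ∈ S, y ⊆ M) (hS' : ∀ y ∈ S', y ⊆ M) :
    freeExt M S ∪ freeExt M S' = freeExt M (S ∪ S') := by
  have hSS' : ∀ y ∈ S ∪ S', y ⊆ M := fun y hy => by
    rcases mem_union.1 hy with h | h
    · exact hS y h
    · exact hS' y h
  ext s
  rw [mem_union, mem_freeExt hS, mem_freeExt hS', mem_freeExt hSS', mem_union]

/-- Membership in a family of subsets of `M` via the extension: `y ∈ S ↔ y ∈ freeExt M S` for
`y ⊆ M`. -/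
theorem mem_freeExt_of_subset (hS : ∀ y ∈ S, y ⊆ M) {y : Finset α} (hyM : y ⊆ M) :
    y ∈ freeExt M S ↔ y ∈ S := by
  rw [mem_freeExt hS, inter_eq_left.2 hyM]

/-- A member of `cofam G` is the complement of a member of `G`. -/
theorem mem_cofam_iff {G : Finset (Finset α)} {w : Finset α} : w ∈ cofam G ↔ univ \ w ∈ G := by
  rw [mem_cofam]
  constructor
  · rintro ⟨y, hy, rfl⟩
    rwa [Finset.sdiff_sdiff_eq_self (subset_univ _)]
  · intro h
    exact ⟨univ \ w, h, Finset.sdiff_sdiff_eq_self (subset_univ _)⟩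

omit [Fintype α] in
/-- Membership in `complWithin M S` for a subset of `M`. -/
theorem mem_complWithin_iff (hS : ∀ y ∈ S, y ⊆ M) {w : Finset α} (hw : w ⊆ M) :
    w ∈ complWithin M S ↔ M \ w ∈ S := by
  rw [mem_complWithin]
  constructor
  · rintro ⟨y, hy, rfl⟩
    rwa [Finset.sdiff_sdiff_eq_self (hS y hy)]
  · intro h
    exact ⟨M \ w, h, Finset.sdiff_sdiff_eq_self hw⟩

omit [Fintype α] in
/-- The members of `complWithin M S` lie inside `M`. -/
theorem subset_of_mem_complWithin {w : Finset α} (hw : w ∈ complWithin M S) : w ⊆ M := by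
  obtain ⟨y, -, rfl⟩ := mem_complWithin.1 hw
  exact sdiff_subset

/-- The complements of the free extension are the free extension of the complements within `M`. -/
theorem cofam_freeExt (hS : ∀ y ∈ S, y ⊆ M) :
    cofam (freeExt M S) = freeExt M (complWithin M S) := by
  ext z
  rw [mem_cofam_iff, mem_freeExt hS, mem_freeExt (fun _ hw => subset_of_mem_complWithin hw),
    mem_complWithin_iff hS inter_subset_right]
  have h1 : (univ \ z) ∩ M = M \ z := by
    ext a
    simp only [mem_inter, mem_sdiff, mem_univ, true_and]
    exact and_comm
  have h2 : M \ (z ∩ M) = M \ z := by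
    ext a
    simp only [mem_sdiff, mem_inter, not_and]
    constructor
    · rintro ⟨haM, h⟩
      exact ⟨haM, fun haz => h haz haM⟩
    · rintro ⟨haM, haz⟩
      exact ⟨haM, fun haz' _ => haz haz'⟩
  rw [h1, h2]

/-- The «below some member of `G`» filter commutes with the free extension. -/
theorem filter_freeExt (hS : ∀ y ∈ S, y ⊆ M) {G : Finset (Finset α)} (hG : ∀ g ∈ G, g ⊆ M) :
    (freeExt M S).filter (fun z => ∃ g ∈ freeExt M G, z ⊆ g) =
      freeExt M (S.filter fun z => ∃ g ∈ G, z ⊆ g) := by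
  ext z
  rw [mem_filter, mem_freeExt hS, mem_freeExt (fun y hy => hS y (mem_filter.1 hy).1), mem_filter]
  constructor
  · rintro ⟨hz, g, hg, hzg⟩
    rw [mem_freeExt hG] at hg
    exact ⟨hz, g ∩ M, hg, inter_subset_inter hzg (Subset.refl _)⟩
  · rintro ⟨hz, g, hg, hzg⟩
    refine ⟨hz, g ∪ (univ \ M), ?_, ?_⟩
    · rw [mem_freeExt hG, union_inter_distrib_right, inter_eq_left.2 (hG g hg),
        Finset.sdiff_inter_self, union_empty]
      exact hg
    · intro a ha
      rw [mem_union, mem_sdiff]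
      by_cases haM : a ∈ M
      · exact Or.inl (hzg (mem_inter.2 ⟨ha, haM⟩))
      · exact Or.inr ⟨mem_univ a, haM⟩

end FreeExt

section LemmaXWithin

variable {U U₀ T : Finset (Finset α)}

/-- **Lemma X within `M`**: for up-sets `U₀ ⊆ U` within `M` with `U ∖ U₀ ≠ ∅` and `T ⊊ U₀`, the
members of `M − U₀` lying below some member of `(U ∖ U₀) ∪ T` number at least `|T| + 1`. -/
theorem lemmaX_within (hUM : ∀ y ∈ U, y ⊆ M) (hU : IsUpSetWithin M U) (hU₀ : IsUpSetWithin M U₀)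
    (hU₀U : U₀ ⊆ U) (hU₁ : (U \ U₀).Nonempty) (hT : T ⊆ U₀) (hTne : T ≠ U₀) :
    T.card + 1 ≤ ((complWithin M U₀).filter fun z => ∃ g ∈ (U \ U₀) ∪ T, z ⊆ g).card := by
  have hU₀M : ∀ y ∈ U₀, y ⊆ M := fun y hy => hUM y (hU₀U hy)
  have hTM : ∀ y ∈ T, y ⊆ M := fun y hy => hU₀M y (hT hy)
  have hUT : ∀ g ∈ (U \ U₀) ∪ T, g ⊆ M := fun g hg => by
    rcases mem_union.1 hg with h | h
    · exact hUM g (mem_sdiff.1 h).1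
    · exact hTM g h
  have hne : (freeExt M U \ freeExt M U₀).Nonempty := by
    obtain ⟨y, hy⟩ := hU₁
    refine ⟨y, ?_⟩
    rw [freeExt_sdiff hUM hU₀M, mem_freeExt_of_subset (fun y hy => hUM y (mem_sdiff.1 hy).1)
      (hUM y (mem_sdiff.1 hy).1)]
    exact hy
  have hTne' : freeExt M T ≠ freeExt M U₀ := by
    intro h
    apply hTne
    refine Subset.antisymm hT fun y hy => ?_
    have : y ∈ freeExt M U₀ := (mem_freeExt_of_subset hU₀M (hU₀M y hy)).2 hy
    rw [← h, mem_freeExt_of_subset hTM (hU₀M y hy)] at this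
    exact this
  have hX := lemmaX (isUpperSet_freeExt hUM hU) (isUpperSet_freeExt hU₀M hU₀)
    (freeExt_subset_freeExt hU₀U) hne (freeExt_subset_freeExt hT) hTne'
  rw [cofam_freeExt hU₀M, freeExt_sdiff hUM hU₀M, freeExt_union (fun y hy => hUM y (mem_sdiff.1 hy).1)
    hTM, filter_freeExt (fun _ hw => subset_of_mem_complWithin hw) hUT, card_freeExt hTM,
    card_freeExt (fun z hz => subset_of_mem_complWithin (mem_filter.1 hz).1)] at hX
  have hpos : 0 < 2 ^ (univ \ M).card := by positivity
  rcases Nat.lt_or_ge T.card ((complWithin M U₀).filter fun z => ∃ g ∈ (U \ U₀) ∪ T, z ⊆ g).card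
    with hlt | hle
  · exact hlt
  · exfalso
    have := Nat.mul_le_mul_right (2 ^ (univ \ M).card) hle
    omega

end LemmaXWithin

end PercRepro.MSTight
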